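import Literature.NumberTheory.Rogawski1990.ArchBouazizSpace              -- ★ (D2-pack): `ArchBouazizSpaceH` with its projections `.weyl`, `.periodic`
import Literature.NumberTheory.Rogawski1990.ArchBouazizClassMapWallTube   -- ★ (W0) LH1-p03 (g7): `exists_forall_mem_of_dist_bzClassMap_lt` (W0-main), `dist_flipAt_flipAt`, `dist_negXAt_negXAt`; brings ★ `ArchBouazizClassMap`
import Literature.NumberTheory.Automorphic.ArchCartanRegularDense          -- ★ `dense_regS`, `mem_closure_regS`
import HarnessLib

/-!
# (W12-asm) VANISHING-JUMP GERMS ARE CLASS MULTIPLES OF THE LEVEL NORMALISER — the glue between the zero-jump gluing (W1′), the class-function realisation at ONE fibre point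
# (W2c) and the class tube (W0-main) that delivers the `hW12` organ of ★ `bzLocalSurjWall_of_parts` with a radius FIXED BEFORE the family
# (Bouaziz 1994 ASENS 27 §3.2 (I₁)–(I₃) pp. 579–580, §4 proof of Thm 4.1.1 pp. 585–586; Shelstad 1979 §4 pp. 22–25)

Topic `NumberTheory/Rogawski1990`; namespace `Literature.NumberTheory.Rogawski1990`.  GROUP-FREE (`W` any finite index type), THEOREMS ONLY (no `def`, no instance, no notation, no
axiom, no `sorry`; §1 symmetry lemmas of Shelstad's half-sum twist and of the compact part of `R_T` carry their own citations).  Cell `pub/hodgecm-mathlib`, crux H413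
(`stmt-HodgeConjecture-24833`), line LH3 (closer stub `stub_N9`, DIRECT ROAD), letter L3′, organ O-L3′-S-WALL = `hwall` of ★ p851480∕p851508; brick (W12-asm) of the W-ROAD CENSUS v1
(LH3-p01 (g6), 6129001bfae4ccc0; dealer RULING #26).  Author LH3-p01 (g6).  Lane `--kind proof --supports stmt-HodgeConjecture-24833`.  Count-neutral.

THE SETTING.  A chart `S`, a base class `b`, a FIBRE POINT `c₀` of `S` over `b` sitting on the walls of the central compact places `P` (`θ₀ = θ₂`) and on the real walls of the central
split places `T` (`x = 0`), regular at the other places; the COMPACT PART OF SHELSTAD'S `R_T`, `Q_S(c) = ∏_{w ∉ S} (1 − e^{i(c_{w,2} − c_{w,0})})` (the LEVEL NORMALISER of the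
filtration assembly: `2π`-periodic, flip character `−e^{i(θ₀−θ₂)}` = ★ `archRH_flipAt`'s, even under `negXAt`, non-zero on `RegS S`; and `archERho S · Q_S = ∏_{w ∉ S} 2i sin((θ₀−θ₂)/2)`).
THE ORGANS (every radius is quantified BEFORE the function it will serve — this is what lets `hwall`'s `ε` precede `Ψ`):
* (W0-main, LH1-p03 (g7), ★ `ArchBouazizClassMapWallTube`, IMPORTED) `exists_forall_mem_of_dist_bzClassMap_lt` — `∀ δ > 0, ∃ ε > 0`: every move-invariant set (angle shifts, flips at
  compact places, `x ↦ −x` at split places) containing `ball c₀ δ` contains the class tube `{dist (bzClassMap S ·) b < ε}`;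
the two remaining organs enter as HYPOTHESES:
* (W1′, LH7-p04 (g6)) `hW1` — ZERO-JUMP GLUING in tube currency: if `D ∈ ArchBouazizSpaceH jcH` vanishes on the regular ε-tubes of the charts `insert w S`, `w ∈ P`, and the ε-tube of
  `S` is regular at the non-central compact places, then `archERho S · D S` agrees on the in-regular part of the ε-tube with a function `C^∞` on the whole (open) ε-tube;
* (W2c, F0P3a-p06 (g20) ⊕ A-p12 (g28)) `hW2` — `∀ δ > 0, ∃ δ′ > 0, ∀ G` smooth on `ball c₀ δ`, ODD under `flipAt w` (`w ∈ P`), EVEN under `negXAt w` (`w ∈ T`):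
  `G = (∏_{w ∉ S} 2i sin((θ₀−θ₂)/2)) · (U ∘ bzClassMap S)` on `ball c₀ δ′` for a smooth `U` on the class space.
THE THEOREM `wallGerm_classMultiple_of_parts` = the `hW12` binder of ★ `bzLocalSurjWall_of_parts` for this chart: `∀ ε > 0, ∃ ε′ > 0, ∀ D ∈ ArchBouazizSpaceH jcH` vanishing on the regular
ε-tubes of the charts `insert w S` (`w ∈ P`), `∃ U` smooth with `D S c = U (bzClassMap S c) · Q_S(c)` on the regular ε′-tube of `S`.  PROOF: glue (`hW1`); the parities of `G = eρ·D` on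
`RegS` from (W) (★ `archRH_flipAt`, §1 `archERho_flipAt ∕ _negXAt`) extend to the ball by density (★ `dense_regS`) and continuity; (W2c) at `c₀`; on `RegS ∩ ball` divide by `eρ ≠ 0`;
the set `{c | c ∈ RegS S → D S c = U(cl c) · Q_S(c)}` is move-invariant (both sides carry the same characters, §1) and contains a ball at `c₀`, so (W0-main) hands the tube.
HONEST LABEL: L3′ stays «S-road organ-complete modulo (Σ-WALL) PRINT» until (W0), (W1′), (W2c), (W3) are ★; HC_CM is proved only modulo the 7 printed citations (2 remaining: hLiu418 =
stmt-HodgeConjecture-24832, h413 = stmt-HodgeConjecture-24833) until rung 0 closes; this file is glue and pays nothing by itself.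

## References
* [Bouaziz1994IntegralesOrbitales] A. Bouaziz, *Intégrales orbitales sur les groupes de Lie réductifs*, Ann. Sci. ÉNS (4) 27 (1994) 573–609, §3.1–3.2 pp. 579–580 ((I₁)–(I₃)), §4
  pp. 585–586 (proof of Thm 4.1.1), §6.2 p. 591.
* [Shelstad1979] D. Shelstad, *Characters and inner forms of a quasi-split group over ℝ*, Compositio Math. 39 (1979), §4 pp. 22–25 (`R_T`, (II), `D̂ = e^{−ρ} D e^{ρ}`), Thm. 4.7 p. 31.
-/

set_option autoImplicit false

noncomputable section

open Complex Set Function Filter Topology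
open Literature.NumberTheory.Automorphic.ArchCartan
open scoped ContDiff

namespace Literature.NumberTheory.Rogawski1990

variable {W : Type*} [Fintype W] [DecidableEq W]

/-! ## §1 The moves: isometries fixing a wall point; the characters of `archERho` and of the compact part of `R_T` -/

section Moves

omit [Fintype W] in
/-- A wall point (`θ₀ = θ₂` at `w`) is FIXED by the flip at `w`. [cite: Shelstad1979, §4 p. 25] -/
theorem flipAt_eq_self_of_eq {w : W} {c : W → Fin 3 → ℝ} (h : c w 0 = c w 2) : flipAt w c = c := by
  funext w' j
  by_cases hw : w' = w
  · subst hw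
    rw [flipAt_apply_self]
    fin_cases j <;> simp [h]
  · rw [flipAt_apply_of_ne hw]

/-- The flip maps the ball at a wall point onto itself. [cite: Shelstad1979, §4 p. 25] -/
theorem flipAt_mem_ball_of_eq {w : W} {c₀ : W → Fin 3 → ℝ} (h : c₀ w 0 = c₀ w 2) {δ : ℝ} {c : W → Fin 3 → ℝ} (hc : c ∈ Metric.ball c₀ δ) :
    flipAt w c ∈ Metric.ball c₀ δ := by
  rw [Metric.mem_ball] at hc ⊢
  rw [← flipAt_eq_self_of_eq h, dist_flipAt_flipAt]
  exact hc

/-- The sign change maps the ball at a real-wall point onto itself. [cite: Shelstad1979, §4 p. 25] -/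
theorem negXAt_mem_ball_of_eq_zero {w : W} {c₀ : W → Fin 3 → ℝ} (h : c₀ w 0 = 0) {δ : ℝ} {c : W → Fin 3 → ℝ} (hc : c ∈ Metric.ball c₀ δ) :
    negXAt w c ∈ Metric.ball c₀ δ := by
  -- the real-wall point is fixed by the sign change (★ `negXAt_eq_self_of_apply_zero`, re-derived in two lines to keep this file's imports group-free)
  have hfix : negXAt w c₀ = c₀ := by
    funext w' j
    by_cases hw : w' = w
    · subst hw
      rw [negXAt_apply_self]
      fin_cases j <;> simp [h]
    · rw [negXAt_apply_of_ne hw]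
  rw [Metric.mem_ball] at hc ⊢
  rw [← hfix, dist_negXAt_negXAt]
  exact hc

/-- **The half-sum twist under the flip at a compact place**: `archERho S (flipAt w c) = e^{i(θ₂−θ₀)} · archERho S c` (the factor `e^{i(θ₀−θ₂)/2}` is conjugated).
[cite: Shelstad1979, §4 p. 24] -/
theorem archERho_flipAt (S : Finset W) {w : W} (hw : w ∉ S) (c : W → Fin 3 → ℝ) :
    archERho S (flipAt w c) = (Circle.exp (c w 2 - c w 0) : ℂ) * archERho S c := by
  unfold archERho
  rw [← Finset.mul_prod_erase Finset.univ _ (Finset.mem_univ w), ← Finset.mul_prod_erase Finset.univ (fun w' => if w' ∈ S then _ else _) (Finset.mem_univ w),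
    if_neg hw, if_neg hw, ← mul_assoc]
  congr 1
  · rw [flipAt_apply_self]
    simp only [Matrix.cons_val_zero, Matrix.cons_val_two, Matrix.tail_cons, Matrix.head_cons]
    rw [← Circle.coe_mul, ← Circle.exp_add]
    congr 2
    ring
  · refine Finset.prod_congr rfl fun w' hw' => ?_
    rw [flipAt_apply_of_ne (Finset.ne_of_mem_erase hw')]

/-- **The half-sum twist ignores the split coordinate**: `archERho S (negXAt w c) = archERho S c` for `w ∈ S`. [cite: Shelstad1979, §4 p. 24] -/
theorem archERho_negXAt (S : Finset W) {w : W} (hw : w ∈ S) (c : W → Fin 3 → ℝ) : archERho S (negXAt w c) = archERho S c := by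
  unfold archERho
  refine Finset.prod_congr rfl fun w' _ => ?_
  by_cases h : w' = w
  · subst h
    rw [if_pos hw, if_pos hw]
  · rw [negXAt_apply_of_ne h]

/-- **The compact part of `R_T` under the flip**: character `−e^{i(θ₀−θ₂)}` (same computation as ★ `archRH_flipAt`, whose split factors are flip-blind). [cite: Shelstad1979, §4 p. 23] -/
theorem compactRH_flipAt (S : Finset W) {w : W} (hw : w ∉ S) (c : W → Fin 3 → ℝ) :
    (∏ w', if w' ∈ S then (1 : ℂ) else (1 - (Circle.exp ((flipAt w c) w' 2 - (flipAt w c) w' 0) : ℂ))) =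
      -(Circle.exp (c w 0 - c w 2) : ℂ) * ∏ w', if w' ∈ S then (1 : ℂ) else (1 - (Circle.exp (c w' 2 - c w' 0) : ℂ)) := by
  rw [← Finset.mul_prod_erase Finset.univ _ (Finset.mem_univ w), ← Finset.mul_prod_erase Finset.univ (fun w' => if w' ∈ S then _ else _) (Finset.mem_univ w),
    if_neg hw, if_neg hw, ← mul_assoc]
  congr 1
  · rw [flipAt_apply_self]
    simp only [Matrix.cons_val_zero, Matrix.cons_val_two, Matrix.tail_cons, Matrix.head_cons]
    have hu : (Circle.exp (c w 0 - c w 2) : ℂ) * (Circle.exp (c w 2 - c w 0) : ℂ) = 1 := by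
      rw [← Circle.coe_mul, ← Circle.exp_add, show c w 0 - c w 2 + (c w 2 - c w 0) = 0 by ring, Circle.exp_zero, Circle.coe_one]
    linear_combination -hu
  · refine Finset.prod_congr rfl fun w' hw' => ?_
    rw [flipAt_apply_of_ne (Finset.ne_of_mem_erase hw')]

/-- The compact part of `R_T` ignores the split coordinate. [cite: Shelstad1979, §4 p. 23] -/
theorem compactRH_negXAt (S : Finset W) {w : W} (hw : w ∈ S) (c : W → Fin 3 → ℝ) :
    (∏ w', if w' ∈ S then (1 : ℂ) else (1 - (Circle.exp ((negXAt w c) w' 2 - (negXAt w c) w' 0) : ℂ))) =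
      ∏ w', if w' ∈ S then (1 : ℂ) else (1 - (Circle.exp (c w' 2 - c w' 0) : ℂ)) := by
  refine Finset.prod_congr rfl fun w' _ => ?_
  by_cases h : w' = w
  · subst h
    rw [if_pos hw, if_pos hw]
  · rw [negXAt_apply_of_ne h]

/-- The compact part of `R_T` is `2π`-periodic in the angle slots (it reads angles through `Circle.exp`; ★ `circleExp_add_angleShift`). [cite: Shelstad1979, §4 p. 22] -/
theorem compactRH_add_angleShift (S : Finset W) (c : W → Fin 3 → ℝ) (w : W) (i : Fin 3) (k : ℤ) :
    (∏ w', if w' ∈ S then (1 : ℂ) else (1 - (Circle.exp ((c + angleShift w i k) w' 2 - (c + angleShift w i k) w' 0) : ℂ))) =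
      ∏ w', if w' ∈ S then (1 : ℂ) else (1 - (Circle.exp (c w' 2 - c w' 0) : ℂ)) := by
  refine Finset.prod_congr rfl fun w' _ => ?_
  by_cases hw' : w' ∈ S
  · rw [if_pos hw', if_pos hw']
  · rw [if_neg hw', if_neg hw', Circle.exp_sub, Circle.exp_sub, circleExp_add_angleShift, circleExp_add_angleShift]

/-- The compact part of `R_T` does not vanish on the regular set (`e^{iθ₀} ≠ e^{iθ₂}` at every compact place; ★ `one_sub_coe_circleExp_sub_ne_zero_iff`).
[cite: Shelstad1979, §4 p. 22] -/
theorem compactRH_ne_zero_of_mem_regS (S : Finset W) {c : W → Fin 3 → ℝ} (hc : c ∈ RegS S) :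
    (∏ w', if w' ∈ S then (1 : ℂ) else (1 - (Circle.exp (c w' 2 - c w' 0) : ℂ))) ≠ 0 := by
  refine Finset.prod_ne_zero_iff.2 fun w' _ => ?_
  by_cases hw' : w' ∈ S
  · rw [if_pos hw']; exact one_ne_zero
  · rw [if_neg hw']
    exact (one_sub_coe_circleExp_sub_ne_zero_iff _ _).2 (hc.1 w' hw')

/-- **`archERho S · Q_S = ∏_{w ∉ S} 2i sin((θ₀ − θ₂)/2)`** — the half-sum twist times the compact part of `R_T` is the product of the `2i sin ψ_w` over the compact places
(the computation of ★ `archERho_mul_archRH`, compact factors only). [cite: Shelstad1979, §4 p. 24] [cite: Bouaziz1994IntegralesOrbitales, §6.2 p. 591] -/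
theorem archERho_mul_compactRH (S : Finset W) (c : W → Fin 3 → ℝ) :
    archERho S c * (∏ w', if w' ∈ S then (1 : ℂ) else (1 - (Circle.exp (c w' 2 - c w' 0) : ℂ))) =
      ∏ w' ∈ Finset.univ \ S, (2 * I * (Real.sin ((c w' 0 - c w' 2) / 2) : ℂ)) := by
  rw [archERho, ← Finset.prod_mul_distrib]
  have h1 : (∏ w', (if w' ∈ S then (1 : ℂ) else (Circle.exp ((c w' 0 - c w' 2) / 2) : ℂ)) * (if w' ∈ S then (1 : ℂ) else (1 - (Circle.exp (c w' 2 - c w' 0) : ℂ)))) =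
      ∏ w', if w' ∈ S then (1 : ℂ) else 2 * I * (Real.sin ((c w' 0 - c w' 2) / 2) : ℂ) := by
    refine Finset.prod_congr rfl fun w' _ => ?_
    by_cases hw' : w' ∈ S
    · rw [if_pos hw', if_pos hw', if_pos hw', one_mul]
    · rw [if_neg hw', if_neg hw', if_neg hw', mul_sub, mul_one, ← Circle.coe_mul, ← Circle.exp_add,
        show (c w' 0 - c w' 2) / 2 + (c w' 2 - c w' 0) = -((c w' 0 - c w' 2) / 2) by ring]
      exact coe_circleExp_sub_coe_circleExp_neg _
  rw [h1, Finset.prod_ite, Finset.prod_const_one, one_mul]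
  refine Finset.prod_congr ?_ fun _ _ => rfl
  ext w'
  simp only [Finset.mem_filter, Finset.mem_univ, true_and, Finset.mem_sdiff]

end Moves

/-! ## §2 The glue: `hW12` of the filtration assembly from (W0-main), (W1′), (W2c) -/

section Glue

/-- **(W12) VANISHING-JUMP GERMS ARE CLASS MULTIPLES OF THE LEVEL NORMALISER, FROM (W1′) AND (W2c) OVER THE ★ CLASS TUBE (W0-main)** (see the module docstring).  The radius `ε′` is
produced BEFORE the family `D`: it depends only on `(S, b, c₀)`, the tube-regularity radius `ε₁`, the input radius `ε`, and the radii of ★ (W0-main)∕(W2c), themselves function-free.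
[cite: Bouaziz1994IntegralesOrbitales, §3.2 (I₁)–(I₃) p. 580; §4 pp. 585–586] [cite: Shelstad1979, Thm. 4.7 (p. 31)] -/
theorem wallGerm_classMultiple_of_parts (jcH : Finset W → W → ℂ) (S P T : Finset W) (b : W → ℂ × ℂ × ℂ)
    (hPS : ∀ w ∈ P, w ∉ S) (hTS : T ⊆ S)
    {c₀ : W → Fin 3 → ℝ} (hc₀ : bzClassMap S c₀ = b) (hc₀P : ∀ w ∈ P, c₀ w 0 = c₀ w 2) (hc₀T : ∀ w ∈ T, c₀ w 0 = 0)
    -- tube regularity at the compact places off `P` (radius `ε₁`)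
    {ε₁ : ℝ} (hε₁ : 0 < ε₁) (hreg₁ : ∀ c : W → Fin 3 → ℝ, dist (bzClassMap S c) b < ε₁ → ∀ w, w ∉ S → w ∉ P → Circle.exp (c w 0) ≠ Circle.exp (c w 2))
    -- (W1′): zero-jump gluing in tube currency
    (hW1 : ∀ ε : ℝ, 0 < ε → (∀ c : W → Fin 3 → ℝ, dist (bzClassMap S c) b < ε → ∀ w, w ∉ S → w ∉ P → Circle.exp (c w 0) ≠ Circle.exp (c w 2)) →
      ∀ D : Finset W → (W → Fin 3 → ℝ) → ℂ, ArchBouazizSpaceH jcH D →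
        (∀ w ∈ P, ∀ c, c ∈ RegS (insert w S) → dist (bzClassMap (insert w S) c) b < ε → D (insert w S) c = 0) →
        ∃ G : (W → Fin 3 → ℝ) → ℂ, ContDiffOn ℝ ∞ G {c | dist (bzClassMap S c) b < ε} ∧ ∀ c, c ∈ InRegS S → dist (bzClassMap S c) b < ε → G c = archERho S c * D S c)
    -- (W2c): class-function realisation at the fibre point (radius before the function)
    (hW2 : ∀ δ : ℝ, 0 < δ → ∃ δ' : ℝ, 0 < δ' ∧ ∀ G : (W → Fin 3 → ℝ) → ℂ, ContDiffOn ℝ ∞ G (Metric.ball c₀ δ) →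
      (∀ w ∈ P, ∀ c ∈ Metric.ball c₀ δ, G (flipAt w c) = -G c) → (∀ w ∈ T, ∀ c ∈ Metric.ball c₀ δ, G (negXAt w c) = G c) →
      ∃ U : (W → ℂ × ℂ × ℂ) → ℂ, ContDiff ℝ ∞ U ∧
        ∀ c ∈ Metric.ball c₀ δ', G c = (∏ w ∈ Finset.univ \ S, (2 * I * (Real.sin ((c w 0 - c w 2) / 2) : ℂ))) * U (bzClassMap S c))
    {ε : ℝ} (hε : 0 < ε) :
    ∃ ε' : ℝ, 0 < ε' ∧ ∀ D : Finset W → (W → Fin 3 → ℝ) → ℂ, ArchBouazizSpaceH jcH D →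
      (∀ w ∈ P, ∀ c, c ∈ RegS (insert w S) → dist (bzClassMap (insert w S) c) b < ε → D (insert w S) c = 0) →
      ∃ U : (W → ℂ × ℂ × ℂ) → ℂ, ContDiff ℝ ∞ U ∧ ∀ c, c ∈ RegS S → dist (bzClassMap S c) b < ε' →
        D S c = U (bzClassMap S c) * ∏ w', if w' ∈ S then (1 : ℂ) else (1 - (Circle.exp (c w' 2 - c w' 0) : ℂ)) := by
  -- the working tube radius `ε₂ = min ε ε₁` and a ball at `c₀` inside that tube
  set ε₂ : ℝ := min ε ε₁ with hε₂def
  have hε₂ : 0 < ε₂ := lt_min hε hε₁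
  have htube : IsOpen {c : W → Fin 3 → ℝ | dist (bzClassMap S c) b < ε₂} :=
    isOpen_lt ((continuous_bzClassMap S).dist continuous_const) continuous_const
  have hc₀tube : c₀ ∈ {c : W → Fin 3 → ℝ | dist (bzClassMap S c) b < ε₂} := by
    show dist (bzClassMap S c₀) b < ε₂
    rw [hc₀, dist_self]; exact hε₂
  obtain ⟨δ, hδ, hball⟩ := Metric.isOpen_iff.1 htube c₀ hc₀tube
  -- the radii of (W2c) and (W0-main)
  obtain ⟨δ', hδ', hU2⟩ := hW2 δ hδ
  obtain ⟨ε', hε', htubeU⟩ := exists_forall_mem_of_dist_bzClassMap_lt S hc₀ (lt_min hδ hδ')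
  refine ⟨ε', hε', fun D hD hvan => ?_⟩
  -- (1) glue on the `ε₂`-tube
  have hreg₂ : ∀ c : W → Fin 3 → ℝ, dist (bzClassMap S c) b < ε₂ → ∀ w, w ∉ S → w ∉ P → Circle.exp (c w 0) ≠ Circle.exp (c w 2) :=
    fun c hc => hreg₁ c (hc.trans_le (min_le_right _ _))
  have hvan₂ : ∀ w ∈ P, ∀ c, c ∈ RegS (insert w S) → dist (bzClassMap (insert w S) c) b < ε₂ → D (insert w S) c = 0 :=
    fun w hw c hc hd => hvan w hw c hc (hd.trans_le (min_le_left _ _))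
  obtain ⟨G, hGs, hGeq⟩ := hW1 ε₂ hε₂ hreg₂ D hD hvan₂
  have hGball : ContDiffOn ℝ ∞ G (Metric.ball c₀ δ) := hGs.mono hball
  have hGcont : ContinuousOn G (Metric.ball c₀ δ) := hGball.continuousOn
  -- (2) the parities of `G = eρ · D` on `RegS ∩ ball`, then on the ball by density
  have hball_reg : ∀ c ∈ Metric.ball c₀ δ, c ∈ RegS S → G c = archERho S c * D S c :=
    fun c hc hcr => hGeq c (regS_subset_inRegS S hcr) (hball hc)
  have hdense : Metric.ball c₀ δ ⊆ closure (RegS S ∩ Metric.ball c₀ δ) := by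
    have h : Metric.ball c₀ δ ⊆ closure (Metric.ball c₀ δ ∩ RegS S) := (dense_regS S).open_subset_closure_inter Metric.isOpen_ball
    rwa [Set.inter_comm] at h
  have hodd : ∀ w ∈ P, ∀ c ∈ Metric.ball c₀ δ, G (flipAt w c) = -G c := by
    intro w hw
    have hwS : w ∉ S := hPS w hw
    -- both sides are continuous on the ball and agree on its regular part
    have h1 : ContinuousOn (fun c => G (flipAt w c)) (Metric.ball c₀ δ) :=
      hGcont.comp (contDiff_flipAt w).continuous.continuousOn fun c hc => flipAt_mem_ball_of_eq (hc₀P w hw) hc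
    have h2 : ContinuousOn (fun c => -G c) (Metric.ball c₀ δ) := hGcont.neg
    have hagree : EqOn (fun c => G (flipAt w c)) (fun c => -G c) (RegS S ∩ Metric.ball c₀ δ) := by
      intro c hc
      have hcr : c ∈ RegS S := hc.1
      have hcb : c ∈ Metric.ball c₀ δ := hc.2
      have hfr : flipAt w c ∈ RegS S := (flipAt_mem_regS_iff S hwS c).2 hcr
      have hfb : flipAt w c ∈ Metric.ball c₀ δ := flipAt_mem_ball_of_eq (hc₀P w hw) hcb
      show G (flipAt w c) = -G c
      rw [hball_reg _ hfb hfr, hball_reg _ hcb hcr, archERho_flipAt S hwS]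
      -- (W) on the regular set: `D S (flipAt w c) = −e^{i(θ₀−θ₂)} · D S c`
      have hW := hD.weyl.1 S c w hwS
      rw [archRH_flipAt S hwS] at hW
      have hR : archRH S c ≠ 0 := archRH_ne_zero_of_mem_regS hcr
      have hDflip : D S (flipAt w c) = -(Circle.exp (c w 0 - c w 2) : ℂ) * D S c := by
        have : (D S (flipAt w c) - -(Circle.exp (c w 0 - c w 2) : ℂ) * D S c) * archRH S c = 0 := by
          rw [sub_mul, hW]; ring
        exact sub_eq_zero.1 ((mul_eq_zero.1 this).resolve_right hR)
      rw [hDflip]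
      have hu : (Circle.exp (c w 2 - c w 0) : ℂ) * (Circle.exp (c w 0 - c w 2) : ℂ) = 1 := by
        rw [← Circle.coe_mul, ← Circle.exp_add, show c w 2 - c w 0 + (c w 0 - c w 2) = 0 by ring, Circle.exp_zero, Circle.coe_one]
      linear_combination (-(archERho S c * D S c)) * hu
    exact hagree.of_subset_closure h1 h2 Set.inter_subset_right hdense
  have heven : ∀ w ∈ T, ∀ c ∈ Metric.ball c₀ δ, G (negXAt w c) = G c := by
    intro w hw
    have hwS : w ∈ S := hTS hw
    have h1 : ContinuousOn (fun c => G (negXAt w c)) (Metric.ball c₀ δ) :=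
      hGcont.comp (contDiff_negXAt w).continuous.continuousOn fun c hc => negXAt_mem_ball_of_eq_zero (hc₀T w hw) hc
    have hagree : EqOn (fun c => G (negXAt w c)) G (RegS S ∩ Metric.ball c₀ δ) := by
      intro c hc
      have hcr : c ∈ RegS S := hc.1
      have hnr : negXAt w c ∈ RegS S := (negXAt_mem_regS_iff S hwS c).2 hcr
      have hnb : negXAt w c ∈ Metric.ball c₀ δ := negXAt_mem_ball_of_eq_zero (hc₀T w hw) hc.2
      show G (negXAt w c) = G c
      rw [hball_reg _ hnb hnr, hball_reg _ hc.2 hcr, archERho_negXAt S hwS, hD.weyl.2 S c w hwS]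
    exact hagree.of_subset_closure h1 hGcont Set.inter_subset_right hdense
  -- (3) class realisation at `c₀`
  obtain ⟨U, hU, hUeq⟩ := hU2 G hGball hodd heven
  refine ⟨U, hU, ?_⟩
  -- (4) the identity on `RegS ∩ ball c₀ (min δ δ')`, then on the tube by move-invariance
  set V : Set (W → Fin 3 → ℝ) := {c | c ∈ RegS S → D S c = U (bzClassMap S c) * ∏ w', if w' ∈ S then (1 : ℂ) else (1 - (Circle.exp (c w' 2 - c w' 0) : ℂ))} with hVdef
  have hVball : Metric.ball c₀ (min δ δ') ⊆ V := by
    intro c hc hcr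
    have hcδ : c ∈ Metric.ball c₀ δ := Metric.ball_subset_ball (min_le_left _ _) hc
    have hcδ' : c ∈ Metric.ball c₀ δ' := Metric.ball_subset_ball (min_le_right _ _) hc
    have h1 := hUeq c hcδ'
    rw [hball_reg c hcδ hcr, ← archERho_mul_compactRH S c] at h1
    -- cancel the unit `archERho S c`
    have hne : archERho S c ≠ 0 := archERho_ne_zero S c
    have h2 : archERho S c * (D S c - U (bzClassMap S c) * ∏ w', if w' ∈ S then (1 : ℂ) else (1 - (Circle.exp (c w' 2 - c w' 0) : ℂ))) = 0 := by
      rw [mul_sub, h1]; ring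
    exact sub_eq_zero.1 ((mul_eq_zero.1 h2).resolve_left hne)
  have hVshift : ∀ c ∈ V, ∀ (w : W) (i : Fin 3) (k : ℤ), (w ∉ S ∨ i ≠ 0) → c + angleShift w i k ∈ V := by
    intro c hc w i k h hcr
    have hcr' : c ∈ RegS S := (add_angleShift_mem_regS_iff S c h k).1 hcr
    rw [hD.periodic S c w i k h, bzClassMap_add_angleShift S c h k, compactRH_add_angleShift S c w i k]
    exact hc hcr'
  have hVflip : ∀ c ∈ V, ∀ w, w ∉ S → flipAt w c ∈ V := by
    intro c hc w hwS hfr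
    have hcr : c ∈ RegS S := (flipAt_mem_regS_iff S hwS c).1 hfr
    have hW := hD.weyl.1 S c w hwS
    rw [archRH_flipAt S hwS] at hW
    have hR : archRH S c ≠ 0 := archRH_ne_zero_of_mem_regS hcr
    have hDflip : D S (flipAt w c) = -(Circle.exp (c w 0 - c w 2) : ℂ) * D S c := by
      have : (D S (flipAt w c) - -(Circle.exp (c w 0 - c w 2) : ℂ) * D S c) * archRH S c = 0 := by
        rw [sub_mul, hW]; ring
      exact sub_eq_zero.1 ((mul_eq_zero.1 this).resolve_right hR)
    rw [hDflip, hc hcr, bzClassMap_flipAt S hwS c, compactRH_flipAt S hwS c]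
    ring
  have hVneg : ∀ c ∈ V, ∀ w, w ∈ S → negXAt w c ∈ V := by
    intro c hc w hwS hnr
    have hcr : c ∈ RegS S := (negXAt_mem_regS_iff S hwS c).1 hnr
    rw [hD.weyl.2 S c w hwS, hc hcr, bzClassMap_negXAt S hwS c, compactRH_negXAt S hwS c]
  intro c hcr hd
  exact htubeU V hVshift hVflip hVneg hVball c hd hcr

end Glue

end Literature.NumberTheory.Rogawski1990

end
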